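import Literature.NumberTheory.GaloisRepresentations.IdeleReadoutLocalHom
import Literature.NumberTheory.GaloisRepresentations.IdeleReadoutArchLocalHom
import Literature.NumberTheory.GaloisRepresentations.IdeleHomAssembly
import HarnessLib

/-!
# `Hom_G(X, J_E) ⊇ ∏'_v {Γ_{K_v}-equivariant X → K̄_vˣ}`: an equivariant idèle-valued homomorphism from LOCAL
# equivariant homomorphisms at every place, unit-valued off a finite set (Milne *ADT* I Lemma 4.13; C–F VII §7.3)

Topic `NumberTheory/GaloisRepresentations`; namespace `Literature.NumberTheory.GaloisRepresentations.IdeleReadout`.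
Definitions with bodies and theorems; NO named fact, no `sorry`, no instance, no notation; number fields in `Type`.
Assembly of door-c5 g17's pieces: `IdeleReadoutLocalHom` (finite places: `assembleLocalHom`, `assembleLocalHomUnit`,
`localReadout`), `IdeleReadoutArchLocalHom` (infinite places: `assembleArchLocalHom`, `archLocalReadout`) and
`IdeleHomAssembly` (`ideleHomOfBlocks`, `ideleRep_hom_ext`).

Why (Route A of crux `AnticycControlAdditiveK`, item 19295).  This is the idèle side of hypothesis (R3) of door-c6
g16's `middleExact_allPlaces_of_readout` (FINDING-door-c6-g16 §3 F6 / §5): "`Hom_G(N₁, J_E) = ∏'_v Hom_{D_w}(N₁, E_wˣ)`"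
— given, for a finite Galois `E/K` (`ιE : E → K̄`) and a `Gal(E/K)`-module `X`, a `Γ_{K_v}`-equivariant homomorphism
`h_v : X → K̄_vˣ` at EVERY place `v` of `K` (finite: `IsLocalHom`, infinite: `IsArchLocalHom`; `Γ_{K_v}` acting on `X`
through `d ↦ d|_E`), with `‖h_v x‖ = 1` for all `x` at the finite places outside a finite set `T`, there is ONE
`Gal(E/K)`-equivariant `f : X → J_E` whose local readouts (`E_{w_v}`-component pushed into `K̄_v` by the distinguished
embedding) are the `h_v` (`ideleHomOfLocalHoms`, `localReadout_ideleHomOfLocalHoms_placeProj`,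
`archLocalReadout_ideleHomOfLocalHoms_infPlaceProj`), and `f` is unique with these readouts
(`ideleRep_hom_ext_of_readouts`).  The local homomorphisms `h_v` are exactly what door-c6's local files produce
(`HomDual.dualδ₀_units_restrict_surjective`, `exists_algNorm_eq_one_of_unramified`).

## What is formalised (`K E : Type` number fields, `[IsGalois K E]`, `ιE : E →ₐ[K] K̄`, `X : Rep ℤ Gal(E/K)`)

* `galRestrict_eq_galRestrictField` (the finite-place restriction of `IdeleReadoutLocalHom` is the general one).
* **`ideleHomOfLocalHoms T hfin hunit hinf : X ⟶ ideleRep K E`** and its readouts: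
  **`ideleHomOfLocalHoms_comp_placeProj`** (`= assembleLocalHom`, every finite `v`),
  **`localReadout_ideleHomOfLocalHoms_placeProj`** (`= h_v`), **`ideleHomOfLocalHoms_comp_infPlaceProj`**,
  **`archLocalReadout_ideleHomOfLocalHoms_infPlaceProj`** (`= h_v`), `ideleHomOfLocalHoms_mem_ideleS` (values in `J_{E,T}`).
* **`ideleRep_hom_ext_of_readouts`**: two `G`-morphisms `X ⟶ J_E` with the same local readouts at all places coincide.

## References
* J. S. Milne, *Arithmetic Duality Theorems* (2nd ed. 2006), I Lemma 4.13 (proof), I §4. [MilneADT2006]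
* J. W. S. Cassels, A. Fröhlich (eds.), *Algebraic Number Theory* (1967), Ch. VII (Tate) §1.1, §7.3. [CasselsFrohlichANT1967]
* D. Harari, *Galois Cohomology and Class Field Theory* (2020), §13.1. [Harari2020]
-/

noncomputable section

open NumberField NumberField.InfinitePlace IsDedekindDomain Field CategoryTheory
open Literature.NumberTheory.Automorphic

namespace Literature.NumberTheory.GaloisRepresentations

namespace IdeleReadout

open SemiLocal ArchHerbrand DiscreteGaloisModule IdeleCohomology

variable {K : Type} [Field K] [NumberField K] {E : Type} [Field E] [NumberField E] [Algebra K E] [IsGalois K E]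
variable (ιE : E →ₐ[K] AlgebraicClosure K) {X : Rep.{0} ℤ (E ≃ₐ[K] E)}

omit [NumberField E] in
/-- The finite-place restriction `galRestrict v ιE` of `IdeleReadoutLocalHom` IS `galRestrictField (K_v) ιE`.
[cite: CasselsFrohlichANT1967, Ch. VII §1.1] -/
theorem galRestrict_eq_galRestrictField (v : HeightOneSpectrum (𝓞 K)) :
    galRestrict v ιE = galRestrictField (v.adicCompletion K) ιE := rfl

section Assembly

variable (T : Finset (HeightOneSpectrum (𝓞 K)))
  {hfin : ∀ v : HeightOneSpectrum (𝓞 K), X.V →+ UnitsCarrier (v.adicCompletion K)}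
  (hfinEq : ∀ v : HeightOneSpectrum (𝓞 K), IsLocalHom v ιE X (hfin v))
  (hunit : ∀ v : HeightOneSpectrum (𝓞 K), v ∉ T → ∀ x : X.V,
    IsNonarchimedeanLocalField.algNorm (v.adicCompletion K)
      (unitsVal (v.adicCompletion K) (hfin v x) : AlgebraicClosure (v.adicCompletion K)) = 1)
  {hinf : ∀ v : InfinitePlace K, X.V →+ UnitsCarrier v.Completion}
  (hinfEq : ∀ v : InfinitePlace K, IsArchLocalHom v ιE X (hinf v))

/-- **The `Gal(E/K)`-equivariant `f : X → J_E` assembled from local equivariant homomorphisms `h_v : X → K̄_vˣ` at all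
places**, unit-valued off the finite set `T` of finite places (semi-local blocks `assembleLocalHom` at `v ∈ T`,
`assembleLocalHomUnit` at `v ∉ T`, `assembleArchLocalHom` at `v ∣ ∞`, glued by `ideleHomOfBlocks`).
[cite: MilneADT2006, I Lemma 4.13 (proof)] [cite: CasselsFrohlichANT1967, Ch. VII §7.3] -/
def ideleHomOfLocalHoms : X ⟶ IdeleClassGroup.ideleRep K E :=
  ideleHomOfBlocks T (fun v => assembleLocalHom (hfinEq v.1))
    (fun v => assembleLocalHomUnit (hfinEq v.1) (hunit v.1 v.2)) (fun v => assembleArchLocalHom (hinfEq v))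

/-- The values lie in `J_{E,T}`. [cite: CasselsFrohlichANT1967, Ch. VII §7.3] -/
theorem ideleHomOfLocalHoms_mem_ideleS (x : X.V) :
    Additive.toMul (α := ideleGroup E) ((ideleHomOfLocalHoms ιE T hfinEq hunit hinfEq).hom x) ∈ ideleS K E T :=
  ideleHomOfBlocks_mem_ideleS T _ _ _ x

/-- **At every finite place the semi-local block of `f` is `assembleLocalHom h_v`** (at `v ∉ T` through
`assembleLocalHomUnit_comp`). [cite: MilneADT2006, I Lemma 4.13 (proof)] -/
theorem ideleHomOfLocalHoms_comp_placeProj (v : HeightOneSpectrum (𝓞 K)) :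
    ideleHomOfLocalHoms ιE T hfinEq hunit hinfEq ≫ placeProj v = assembleLocalHom (hfinEq v) := by
  by_cases hv : v ∈ T
  · exact ideleHomOfBlocks_comp_placeProj_of_mem T _ _ _ hv
  · rw [ideleHomOfLocalHoms, ideleHomOfBlocks_comp_placeProj_of_not_mem T _ _ _ hv]
    exact assembleLocalHomUnit_comp (hfinEq v) (hunit v hv)

/-- **The local readout of `f` at a finite place `v` is `h_v`.** [cite: MilneADT2006, I Lemma 4.13 (proof)] -/
theorem localReadout_ideleHomOfLocalHoms_placeProj (v : HeightOneSpectrum (𝓞 K)) :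
    localReadout v ιE (ideleHomOfLocalHoms ιE T hfinEq hunit hinfEq ≫ placeProj v) = hfin v := by
  rw [ideleHomOfLocalHoms_comp_placeProj, localReadout_assembleLocalHom]

/-- **At every infinite place the archimedean block of `f` is `assembleArchLocalHom h_v`.**
[cite: MilneADT2006, I Lemma 4.13 (proof)] -/
theorem ideleHomOfLocalHoms_comp_infPlaceProj (v : InfinitePlace K) :
    ideleHomOfLocalHoms ιE T hfinEq hunit hinfEq ≫ infPlaceProj v = assembleArchLocalHom (hinfEq v) :=
  ideleHomOfBlocks_comp_infPlaceProj T _ _ _ v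

/-- **The local readout of `f` at an infinite place `v` is `h_v`.** [cite: MilneADT2006, I Lemma 4.13 (proof)] -/
theorem archLocalReadout_ideleHomOfLocalHoms_infPlaceProj (v : InfinitePlace K) :
    archLocalReadout v ιE (ideleHomOfLocalHoms ιE T hfinEq hunit hinfEq ≫ infPlaceProj v) = hinf v := by
  rw [ideleHomOfLocalHoms_comp_infPlaceProj, archLocalReadout_assembleArchLocalHom]

end Assembly

/-- **Uniqueness: a `G`-morphism `X ⟶ J_E` is determined by its local readouts at all places.**
[cite: MilneADT2006, I Lemma 4.13 (proof)] [cite: CasselsFrohlichANT1967, Ch. VII §7.3] -/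
theorem ideleRep_hom_ext_of_readouts {f g : X ⟶ IdeleClassGroup.ideleRep K E}
    (hfin : ∀ v : HeightOneSpectrum (𝓞 K), localReadout v ιE (f ≫ placeProj v) = localReadout v ιE (g ≫ placeProj v))
    (hinf : ∀ v : InfinitePlace K, archLocalReadout v ιE (f ≫ infPlaceProj v) = archLocalReadout v ιE (g ≫ infPlaceProj v)) :
    f = g :=
  ideleRep_hom_ext (fun v => hom_ext_of_localReadout_eq (hfin v)) (fun v => arch_hom_ext_of_archLocalReadout_eq (hinf v))

/-- **The readouts of any `G`-morphism `f : X ⟶ J_E` are local equivariant homomorphisms, unit-valued off a finite set `T`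
whenever `f` takes values in `J_{E,T}`** (converse direction: every equivariant `f` arises from `ideleHomOfLocalHoms`).
[cite: MilneADT2006, I Lemma 4.13 (proof)] -/
theorem algNorm_localReadout_eq_one_of_mem_ideleS (f : X ⟶ IdeleClassGroup.ideleRep K E) (T : Finset (HeightOneSpectrum (𝓞 K)))
    (hf : ∀ x : X.V, Additive.toMul (α := ideleGroup E) (f.hom x) ∈ ideleS K E T)
    {v : HeightOneSpectrum (𝓞 K)} (hv : v ∉ T) (x : X.V) :
    IsNonarchimedeanLocalField.algNorm (v.adicCompletion K)
      (unitsVal (v.adicCompletion K) (localReadout v ιE (f ≫ placeProj v) x) : AlgebraicClosure (v.adicCompletion K)) = 1 := by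
  rw [coe_unitsVal_localReadout, ← mem_placeUnitGroup_iff_algNorm_placeEmb, mem_placeUnitGroup_iff, val_toMul_unitsProj,
    Rep.comp_apply]
  exact hf x _ (by rw [(embPlace v ιE).under_eq]; exact hv)

/-- **`f = ideleHomOfLocalHoms` of its own readouts** (for `f` with values in `J_{E,T}`).
[cite: MilneADT2006, I Lemma 4.13 (proof)] -/
theorem eq_ideleHomOfLocalHoms_readouts (f : X ⟶ IdeleClassGroup.ideleRep K E) (T : Finset (HeightOneSpectrum (𝓞 K)))
    (hf : ∀ x : X.V, Additive.toMul (α := ideleGroup E) (f.hom x) ∈ ideleS K E T) :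
    f = ideleHomOfLocalHoms ιE T (fun v => isLocalHom_localReadout v ιE (f ≫ placeProj v))
      (fun _ hv x => algNorm_localReadout_eq_one_of_mem_ideleS ιE f T hf hv x)
      (fun v => isArchLocalHom_archLocalReadout v ιE (f ≫ infPlaceProj v)) :=
  ideleRep_hom_ext_of_readouts ιE
    (fun v => (localReadout_ideleHomOfLocalHoms_placeProj ιE T
      (hfin := fun v => localReadout v ιE (f ≫ placeProj v)) (hinf := fun v => archLocalReadout v ιE (f ≫ infPlaceProj v))
      _ _ _ v).symm)
    (fun v => (archLocalReadout_ideleHomOfLocalHoms_infPlaceProj ιE T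
      (hfin := fun v => localReadout v ιE (f ≫ placeProj v)) (hinf := fun v => archLocalReadout v ιE (f ≫ infPlaceProj v))
      _ _ _ v).symm)

end IdeleReadout

end Literature.NumberTheory.GaloisRepresentations

end
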